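import Summits.QuantumFields.YangMills.Theorems.LuscherReductionTwistedTraceScalingGaugeActionRelLinkVec
import Summits.QuantumFields.YangMills.Theorems.LuscherReductionTwistedTraceScalingOrthoTransverseRotation
import Summits.QuantumFields.YangMills.Theorems.LuscherReductionTwistedTraceScalingRecordWeight
import HarnessLib

/-!
# Linearisation of the transverse coordinate under the gauge action at a GENERAL slow variable `u`: the covariant gradient
# (lane A of S-BASE, crux `TwistedTraceScaling` stmt-QuantumFields-20203, C4 INNER; design note `pub/ym-fleet/ym-luscher-20007-p1/COARSE-DESIGN.md` §23.6 (N1)–(N2))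

`…GaugeActionRelLinkVec` linearised the relative link coordinate `relLinkVec` of `W^h`, `W = orthoTube 1 w`, in the gauge parameter `ξ` (`h_x = P(ξ_x)`):
the linear part is `w + vacGrad ξ`-like.  The Born–Oppenheimer core is `|c| ≤ β^{-s}`, not `c = 0`, so the successor needs the same statement at a general
slow variable `u ∈ SU(2)³`.  THIS FILE:
* §1 an ABSTRACT polar-mean lemma (the second half of the `u = 1` proof, once and for all): if every link of a configuration `V` has scalar part `≥ 1/2` and
  vector part within `ρ` of a «linear prediction» `lin_e` whose direction sums vanish, then `‖(V_e · p_k(V)⁻¹)⃗ − lin_e‖∞ ≤ 11ρ` (★ `norm_relLink_sub_lin_le`);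
* §2 right-constant invariance: `dirQuat (V·constLift u) = dirQuat V · q(u_k)`, `polarMean (V·constLift u) = polarMean V · u_k`, hence ★ `relLinkVec (V·constLift u) = relLinkVec V`
  (the relative coordinate does not see a constant right factor — the tube structure);
* §3 the gauge action at slow variable `u`: `(orthoTube u w)^h = covRel u ξ w · constLift u` with `covRel_e = P(ξ_x)·P(w_e)·P(Ad(u_k)ξ_y)⁻¹` (★ `gaugeTransform_orthoTube_eq`),
  and for MEAN-ZERO `ξ` (`Σ_x ξ_x = 0`, the complement of the constant gauge transformations, which move `u` itself) and balanced capped `w`: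
  ★★ `norm_relLinkVec_gaugeTransform_orthoTube_sub_le`: `‖relLinkVec((orthoTube u w)^h)_e − (w_e + ξ_x − Ad(u_k)ξ_y)‖∞ ≤ 440·(4G² + 2Gω)` for `‖ξ_x‖∞ ≤ G ≤ 1/40`,
  `‖w_e‖∞ ≤ ω ≤ 1/20` — the linear part is `w − D_u ξ` with `D_u` the COVARIANT gradient at `constLift u` (`covGrad`; `covGrad 1 = vacGrad` componentwise).
So along a based gauge orbit through a tube point the slice functional `P_Γ relLinkVec` moves, to first order, by `−P_Γ D_u ξ`, an isomorphism `{Σξ = 0} → Γ` for `u`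
near `1` (`…VacGradKernel`): the input of (N1) «every inner orbit meets the slice» and of the Laplace evaluation (N2) of the Faddeev–Popov weight `N`.
HONEST FRAMING: finite-dimensional algebra for a stub of a child of the CONDITIONAL reduction route R2b1; no spectral claim; C4 OPEN; not a gap, not Clay.
-/

set_option autoImplicit false

noncomputable section

open MeasureTheory Filter Topology Real
open scoped BigOperators Matrix Quaternion
open Literature.MathematicalPhysics.QuantumFieldTheory
open Literature.MathematicalPhysics.QuantumLattice

namespace Summit.QuantumFields.YangMills.Theorems.FemtoTransferGap.TwoLattice.ConstTube

open Summit.QuantumFields.YangMills.Theorems.FemtoTransferGap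
open Summit.QuantumFields.YangMills.Theorems.FemtoTransferGap.TwoLattice.Cov (sum_sq_adRot_mulVec abs_vecPart_le_one)
open Literature.Algebra.EuclideanLattices (abs_apply_le_norm)

variable (L : ℕ) [NeZero L]

/-! ## §1 The abstract polar-mean lemma -/

section Abstract

variable {L}
variable {V : GaugeConfig 3 L SU2} {lin : Edge 3 L → Fin 3 → ℝ} {ρ : ℝ}
  (hlin : ∀ e, ‖vecPart (V e) - lin e‖ ≤ ρ) (hhalf : ∀ e, 1 / 2 ≤ scalarPart (V e))
  (hsum : ∀ k : Fin 3, ∑ x : Site 3 L, lin (x, k) = 0)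

include hlin hsum in
/-- The vector sum of a direction is within `N·ρ` of zero when the linear predictions sum to zero. [folklore] -/
theorem norm_dirVecSum_le_of_lin (k : Fin 3) : ‖dirVecSum L k V‖ ≤ Fintype.card (Site 3 L) * ρ := by
  have hsplit : dirVecSum L k V = ∑ x : Site 3 L, (vecPart (V (x, k)) - lin (x, k)) := by
    rw [Finset.sum_sub_distrib, hsum k, sub_zero]; rfl
  rw [hsplit]
  calc ‖∑ x : Site 3 L, (vecPart (V (x, k)) - lin (x, k))‖ ≤ ∑ x : Site 3 L, ‖vecPart (V (x, k)) - lin (x, k)‖ := norm_sum_le _ _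
    _ ≤ ∑ _x : Site 3 L, ρ := Finset.sum_le_sum fun x _ => hlin (x, k)
    _ = Fintype.card (Site 3 L) * ρ := by rw [Finset.sum_const, Finset.card_univ, nsmul_eq_mul]

include hhalf in
/-- The scalar sum of a direction is at least `N/2`. [folklore] -/
theorem dirScalarSum_ge_of_half (k : Fin 3) : (Fintype.card (Site 3 L) : ℝ) / 2 ≤ dirScalarSum L k V := by
  unfold dirScalarSum
  calc (Fintype.card (Site 3 L) : ℝ) / 2 = ∑ _x : Site 3 L, (1 / 2 : ℝ) := by
        rw [Finset.sum_const, Finset.card_univ, nsmul_eq_mul]; ring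
    _ ≤ _ := Finset.sum_le_sum fun x _ => hhalf (x, k)

include hlin hhalf hsum in
/-- ★ The polar mean moves only at second order: `‖p⃗_k‖∞ ≤ 2ρ`, `0 ≤ 1 − (p_k)₀ ≤ 4ρ`. [folklore] -/
theorem polarMean_parts_small_of_lin (k : Fin 3) :
    ‖vecPart (polarMean L k V)‖ ≤ 2 * ρ ∧ 0 ≤ 1 - scalarPart (polarMean L k V) ∧ 1 - scalarPart (polarMean L k V) ≤ 4 * ρ := by
  set N : ℝ := (Fintype.card (Site 3 L) : ℝ) with hN
  have hNpos : 0 < N := by rw [hN]; exact_mod_cast Fintype.card_pos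
  have hS := dirScalarSum_ge_of_half hhalf k
  have hSpos : 0 < dirScalarSum L k V := by linarith
  have hM0 : dirQuat L k V ≠ 0 := dirQuat_ne_zero_of_scalarSum_pos L hSpos
  obtain ⟨hs, hv⟩ := parts_polarMean L hM0
  have hV := norm_dirVecSum_le_of_lin hlin hsum k
  have hρ0 : 0 ≤ ρ := (norm_nonneg _).trans (hlin ((0 : Site 3 L), k))
  set S := dirScalarSum L k V with hSdef
  set W := dirVecSum L k V with hWdef
  have hMnorm : ‖dirQuat L k V‖ = √(S ^ 2 + ∑ a, W a ^ 2) := norm_dirQuat L k V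
  have hW2 : ∑ a, W a ^ 2 ≤ 3 * ‖W‖ ^ 2 := sum_sq_le_three_norm_sq W
  have hW0 : 0 ≤ ‖W‖ := norm_nonneg W
  have hMge : S ≤ ‖dirQuat L k V‖ := by
    rw [hMnorm]
    calc S = √(S ^ 2) := (Real.sqrt_sq hSpos.le).symm
      _ ≤ √(S ^ 2 + ∑ a, W a ^ 2) := Real.sqrt_le_sqrt (le_add_of_nonneg_right (Finset.sum_nonneg fun a _ => sq_nonneg _))
  have hMle : ‖dirQuat L k V‖ ≤ S + 2 * ‖W‖ := by
    rw [hMnorm]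
    calc √(S ^ 2 + ∑ a, W a ^ 2) ≤ √((S + 2 * ‖W‖) ^ 2) := Real.sqrt_le_sqrt (by nlinarith)
      _ = S + 2 * ‖W‖ := Real.sqrt_sq (by linarith)
  have hMpos : 0 < ‖dirQuat L k V‖ := hSpos.trans_le hMge
  have hWS : ‖W‖ ≤ N * ρ := hV
  have hS2 : N / 2 ≤ S := hS
  refine ⟨?_, ?_, ?_⟩
  · rw [hv, norm_smul_real, abs_of_pos (inv_pos.mpr hMpos), inv_mul_le_iff₀ hMpos]
    calc ‖W‖ ≤ N * ρ := hWS
      _ ≤ S * (2 * ρ) := by nlinarith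
      _ ≤ ‖dirQuat L k V‖ * (2 * ρ) := mul_le_mul_of_nonneg_right hMge (by positivity)
  · rw [hs, sub_nonneg, inv_mul_le_iff₀ hMpos, mul_one]; exact hMge
  · rw [hs]
    have h1 : 1 - ‖dirQuat L k V‖⁻¹ * S = (‖dirQuat L k V‖ - S) / ‖dirQuat L k V‖ := by field_simp
    rw [h1, div_le_iff₀ hMpos]
    calc ‖dirQuat L k V‖ - S ≤ 2 * ‖W‖ := by linarith
      _ ≤ 2 * (N * ρ) := by linarith
      _ ≤ 4 * ρ * S := by nlinarith
      _ ≤ 4 * ρ * ‖dirQuat L k V‖ := mul_le_mul_of_nonneg_left hMge (by positivity)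

include hlin hhalf hsum in
/-- ★ **ABSTRACT LINEARISATION OF THE RELATIVE LINK COORDINATE**: `‖(V_e · p_{dir e}(V)⁻¹)⃗ − lin_e‖∞ ≤ 11ρ`. [folklore] -/
theorem norm_relLink_sub_lin_le (e : Edge 3 L) : ‖vecPart (V e * (polarMean L e.2 V)⁻¹) - lin e‖ ≤ 11 * ρ := by
  set p := polarMean L e.2 V with hp
  obtain ⟨hvp, hsp0, hsp⟩ := polarMean_parts_small_of_lin hlin hhalf hsum e.2
  rw [← hp] at hvp hsp0 hsp
  have h1 : ‖vecPart (V e) - lin e‖ ≤ ρ := hlin e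
  have hve : ‖vecPart (V e)‖ ≤ 1 := norm_vecPart_le_one (V e)
  have hse : |scalarPart (V e)| ≤ 1 := abs_scalarPart_le (V e)
  have hρ0 : 0 ≤ ρ := (norm_nonneg _).trans (hlin e)
  have hdec : vecPart (V e * p⁻¹) - lin e =
      (vecPart (V e) - lin e) + (scalarPart p - 1) • vecPart (V e) - scalarPart (V e) • vecPart p - vecPart (V e) ⨯₃ vecPart p := by
    rw [vecPart_mul_inv]; module
  rw [hdec]
  have hT2 : ‖(scalarPart p - 1) • vecPart (V e)‖ ≤ 4 * ρ := by
    rw [norm_smul_real, show |scalarPart p - 1| = 1 - scalarPart p by rw [abs_sub_comm]; exact abs_of_nonneg hsp0]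
    calc (1 - scalarPart p) * ‖vecPart (V e)‖ ≤ (4 * ρ) * 1 := mul_le_mul hsp hve (norm_nonneg _) (by positivity)
      _ = 4 * ρ := mul_one _
  have hT3 : ‖scalarPart (V e) • vecPart p‖ ≤ 2 * ρ := by
    rw [norm_smul_real]
    calc |scalarPart (V e)| * ‖vecPart p‖ ≤ 1 * (2 * ρ) := mul_le_mul hse hvp (norm_nonneg _) zero_le_one
      _ = 2 * ρ := one_mul _
  have hT4 : ‖vecPart (V e) ⨯₃ vecPart p‖ ≤ 4 * ρ := by
    calc ‖vecPart (V e) ⨯₃ vecPart p‖ ≤ 2 * (‖vecPart (V e)‖ * ‖vecPart p‖) := norm_cross_le_two _ _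
      _ ≤ 2 * (1 * (2 * ρ)) := by
          have := mul_le_mul hve hvp (norm_nonneg _) zero_le_one
          linarith
      _ = 4 * ρ := by ring
  have e1 := norm_sub_le ((vecPart (V e) - lin e) + (scalarPart p - 1) • vecPart (V e) - scalarPart (V e) • vecPart p) (vecPart (V e) ⨯₃ vecPart p)
  have e2 := norm_sub_le ((vecPart (V e) - lin e) + (scalarPart p - 1) • vecPart (V e)) (scalarPart (V e) • vecPart p)
  have e3 := norm_add_le (vecPart (V e) - lin e) ((scalarPart p - 1) • vecPart (V e))
  linarith only [e1, e2, e3, h1, hT2, hT3, hT4]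

end Abstract

/-! ## §2 A constant right factor does not change the relative coordinate -/

/-- `dirQuat (V · constLift u) = dirQuat V · q(u_k)` (quaternion product). [folklore] -/
theorem dirQuat_mul_constLift (V : GaugeConfig 3 L SU2) (u : GaugeConfig 3 1 SU2) (k : Fin 3) :
    dirQuat L k (V * constLift L u) = dirQuat L k V * su2Quat (u (0, k)) := by
  have hlink : ∀ x : Site 3 L, (V * constLift L u) (x, k) = V (x, k) * u (0, k) := fun x => by
    rw [Pi.mul_apply, constLift_apply]
  have hs : dirScalarSum L k (V * constLift L u) = dirScalarSum L k V * scalarPart (u (0, k)) - dirVecSum L k V ⬝ᵥ vecPart (u (0, k)) := by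
    simp only [dirScalarSum, dirVecSum, hlink, scalarPart_mul, Finset.sum_sub_distrib, Finset.sum_mul, sum_dotProduct]
  have hv : dirVecSum L k (V * constLift L u) =
      dirScalarSum L k V • vecPart (u (0, k)) + scalarPart (u (0, k)) • dirVecSum L k V + dirVecSum L k V ⨯₃ vecPart (u (0, k)) := by
    simp only [dirScalarSum, dirVecSum, hlink, vecPart_mul, Finset.sum_add_distrib, Finset.sum_smul, Finset.smul_sum, LinearMap.map_sum₂]
  have hre : (su2Quat (u (0, k))).re = scalarPart (u (0, k)) := rfl
  have hI : (su2Quat (u (0, k))).imI = vecPart (u (0, k)) 0 := rfl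
  have hJ : (su2Quat (u (0, k))).imJ = vecPart (u (0, k)) 1 := rfl
  have hK : (su2Quat (u (0, k))).imK = vecPart (u (0, k)) 2 := rfl
  have hc0 : (dirVecSum L k V ⨯₃ vecPart (u (0, k))) 0 = dirVecSum L k V 1 * vecPart (u (0, k)) 2 - dirVecSum L k V 2 * vecPart (u (0, k)) 1 := rfl
  have hc1 : (dirVecSum L k V ⨯₃ vecPart (u (0, k))) 1 = dirVecSum L k V 2 * vecPart (u (0, k)) 0 - dirVecSum L k V 0 * vecPart (u (0, k)) 2 := rfl
  have hc2 : (dirVecSum L k V ⨯₃ vecPart (u (0, k))) 2 = dirVecSum L k V 0 * vecPart (u (0, k)) 1 - dirVecSum L k V 1 * vecPart (u (0, k)) 0 := rfl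
  ext
  · show dirScalarSum L k (V * constLift L u) = _
    rw [Quaternion.re_mul, hs, hre, hI, hJ, hK, Matrix.vec3_dotProduct]
    show _ = dirScalarSum L k V * _ - dirVecSum L k V 0 * _ - dirVecSum L k V 1 * _ - dirVecSum L k V 2 * _
    ring
  · show dirVecSum L k (V * constLift L u) 0 = _
    rw [Quaternion.imI_mul, hv, hre, hI, hJ, hK, Pi.add_apply, Pi.add_apply, Pi.smul_apply, Pi.smul_apply, smul_eq_mul, smul_eq_mul, hc0]
    show _ = dirScalarSum L k V * _ + dirVecSum L k V 0 * _ + dirVecSum L k V 1 * _ - dirVecSum L k V 2 * _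
    ring
  · show dirVecSum L k (V * constLift L u) 1 = _
    rw [Quaternion.imJ_mul, hv, hre, hI, hJ, hK, Pi.add_apply, Pi.add_apply, Pi.smul_apply, Pi.smul_apply, smul_eq_mul, smul_eq_mul, hc1]
    show _ = dirScalarSum L k V * _ - dirVecSum L k V 0 * _ + dirVecSum L k V 1 * _ + dirVecSum L k V 2 * _
    ring
  · show dirVecSum L k (V * constLift L u) 2 = _
    rw [Quaternion.imK_mul, hv, hre, hI, hJ, hK, Pi.add_apply, Pi.add_apply, Pi.smul_apply, Pi.smul_apply, smul_eq_mul, smul_eq_mul, hc2]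
    show _ = dirScalarSum L k V * _ + dirVecSum L k V 0 * _ - dirVecSum L k V 1 * _ + dirVecSum L k V 2 * _
    ring

omit [NeZero L] in
/-- Right multiplication in `SU(2)` is right multiplication by the unit quaternion before projecting: `quatToSU2 (x · q(U)) = quatToSU2 x · U` (`x ≠ 0`).
[folklore] -/
theorem quatToSU2_mul_su2Quat {x : ℍ} (hx : x ≠ 0) (U : SU2) : quatToSU2 (x * su2Quat U) = quatToSU2 x * U := by
  have hq := norm_su2Quat U
  have hqx : x * su2Quat U ≠ 0 := mul_ne_zero hx (su2Quat_ne_zero U)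
  apply Subtype.ext
  rw [Submonoid.coe_mul, coe_quatToSU2 hx, coe_quatToSU2 hqx, ← quatMatrix_su2Quat U, ← quatMatrix_mul, smul_mul_assoc, norm_mul, hq, mul_one]

/-- ★ `polarMean (V · constLift u) = polarMean V · u_k` (when the direction sum of `V` is nonzero). [folklore] -/
theorem polarMean_mul_constLift (V : GaugeConfig 3 L SU2) (u : GaugeConfig 3 1 SU2) {k : Fin 3} (h : dirQuat L k V ≠ 0) :
    polarMean L k (V * constLift L u) = polarMean L k V * u (0, k) := by
  unfold polarMean
  rw [dirQuat_mul_constLift, quatToSU2_mul_su2Quat h]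

/-- ★ **The relative coordinate does not see a constant right factor**: `relLinkVec (V · constLift u) = relLinkVec V` (direction sums of `V` nonzero). [folklore] -/
theorem relLinkVec_mul_constLift (V : GaugeConfig 3 L SU2) (u : GaugeConfig 3 1 SU2) (h : ∀ k : Fin 3, dirQuat L k V ≠ 0) :
    relLinkVec L (V * constLift L u) = relLinkVec L V := by
  unfold relLinkVec
  congr 1
  funext ea
  rw [polarMean_mul_constLift L V u (h ea.1.2), Pi.mul_apply, constLift_apply, mul_inv_rev, ← mul_assoc, mul_assoc (V ea.1), mul_inv_cancel, mul_one]

/-- Hence `gaugeCoordSq (V · constLift u) = gaugeCoordSq V`. [folklore] -/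
theorem gaugeCoordSq_mul_constLift (V : GaugeConfig 3 L SU2) (u : GaugeConfig 3 1 SU2) (h : ∀ k : Fin 3, dirQuat L k V ≠ 0) :
    gaugeCoordSq L (V * constLift L u) = gaugeCoordSq L V := by
  unfold gaugeCoordSq; rw [relLinkVec_mul_constLift L V u h]

/-! ## §3 The gauge action at a general slow variable: the covariant gradient -/

/-- The covariant relative configuration of `(orthoTube u w)^h`, `h = P∘ξ`: `covRel u ξ w e = P(ξ_x)·P(w_e)·P(Ad(u_k) ξ_y)⁻¹`. [folklore] -/
def covRel (u : GaugeConfig 3 1 SU2) (ξ : Site 3 L → Fin 3 → ℝ) (w : Edge 3 L → Fin 3 → ℝ) : GaugeConfig 3 L SU2 :=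
  fun e => chartSU2 (ξ e.1) * chartSU2 (w e) * (chartSU2 ((adRot (u (0, e.2))).mulVec (ξ (e.1.shift e.2))))⁻¹

/-- The covariant gradient at the constant configuration `constLift u` acting on a site field: `(covGrad u ξ)_{(x,k)} = Ad(u_k) ξ_{x+k} − ξ_x`
(at `u = 1` this is `vacGrad`). [folklore] -/
def covGrad (u : GaugeConfig 3 1 SU2) (ξ : Site 3 L → Fin 3 → ℝ) : Edge 3 L → Fin 3 → ℝ :=
  fun e => (adRot (u (0, e.2))).mulVec (ξ (e.1.shift e.2)) - ξ e.1

omit [NeZero L] in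
/-- At `u = 1` the covariant gradient is the vacuum gradient (componentwise). [folklore] -/
theorem covGrad_one (ξ : Site 3 L → Fin 3 → ℝ) (e : Edge 3 L) : covGrad L 1 ξ e = ξ (e.1.shift e.2) - ξ e.1 := by
  simp [covGrad, Cov.adRot_one]

omit [NeZero L] in
/-- ★ **The gauge action at slow variable `u`**: `(orthoTube u w)^h = covRel u ξ w · constLift u` for `h = P∘ξ` (on the cap `Σ ξ_y² ≤ 1`). [folklore] -/
theorem gaugeTransform_orthoTube_eq (u : GaugeConfig 3 1 SU2) (ξ : Site 3 L → Fin 3 → ℝ) (w : Edge 3 L → Fin 3 → ℝ) (hξ : ∀ x, ∑ a, ξ x a ^ 2 ≤ 1) :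
    gaugeTransform (fun x => chartSU2 (ξ x)) (orthoTube L u w) = covRel L u ξ w * constLift L u := by
  funext e
  rw [Pi.mul_apply, constLift_apply]
  simp only [gaugeTransform, covRel, orthoTube_apply]
  rw [chartSU2_adRot _ (hξ _), mul_inv_rev, mul_inv_rev, inv_inv]
  simp only [mul_assoc, inv_mul_cancel, mul_one]

omit [NeZero L] in
/-- Sup norm of a rotated vector: `‖Ad(r) ξ‖∞ ≤ 2‖ξ‖∞`. [folklore] -/
theorem norm_adRot_mulVec_le (r : SU2) (ξ : Fin 3 → ℝ) : ‖(adRot r).mulVec ξ‖ ≤ 2 * ‖ξ‖ := by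
  refine (pi_norm_le_iff_of_nonneg (by positivity)).mpr fun a => ?_
  rw [Real.norm_eq_abs]
  have h1 : ((adRot r).mulVec ξ a) ^ 2 ≤ ∑ b, ((adRot r).mulVec ξ b) ^ 2 :=
    Finset.single_le_sum (fun b _ => sq_nonneg _) (Finset.mem_univ a)
  rw [sum_sq_adRot_mulVec] at h1
  have h2 := sum_sq_le_three_norm_sq ξ
  have h0 : 0 ≤ ‖ξ‖ := norm_nonneg ξ
  exact abs_le_of_sq_le_sq (by nlinarith) (by positivity)

variable {L} in
/-- The direction sums of the linear prediction vanish for MEAN-ZERO `ξ` and balanced `w`. [folklore] -/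
theorem sum_covLin_eq_zero (u : GaugeConfig 3 1 SU2) {ξ : Site 3 L → Fin 3 → ℝ} {w : Edge 3 L → Fin 3 → ℝ}
    (hbal : ∀ (k : Fin 3) (a : Fin 3), ∑ x : Site 3 L, w (x, k) a = 0) (hmean : ∑ x : Site 3 L, ξ x = 0) (k : Fin 3) :
    ∑ x : Site 3 L, (w (x, k) + ξ x - (adRot (u (0, k))).mulVec (ξ (x.shift k))) = 0 := by
  have hw0 : ∑ x : Site 3 L, w (x, k) = 0 := by
    funext a; rw [Finset.sum_apply, Pi.zero_apply]; exact hbal k a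
  have hrot : ∑ x : Site 3 L, (adRot (u (0, k))).mulVec (ξ (x.shift k)) = (adRot (u (0, k))).mulVec (∑ x : Site 3 L, ξ (x.shift k)) := by
    simp_rw [← Matrix.mulVecLin_apply]; rw [map_sum]
  rw [Finset.sum_sub_distrib, Finset.sum_add_distrib, hw0, zero_add, hrot, sum_shift_eq L ξ k, hmean, Matrix.mulVec_zero, sub_zero]

section Main

variable {L}
variable {u : GaugeConfig 3 1 SU2} {ξ : Site 3 L → Fin 3 → ℝ} {w : Edge 3 L → Fin 3 → ℝ} {G ω : ℝ}
  (hG : ∀ x, ‖ξ x‖ ≤ G) (hω : ∀ e, ‖w e‖ ≤ ω) (hG1 : G ≤ 1 / 40) (hω1 : ω ≤ 1 / 20)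

include hG hω hG1 hω1

omit [NeZero L] in
/-- Per link: `‖(covRel u ξ w e)⃗ − (w_e + ξ_x − Ad(u_k)ξ_y)‖∞ ≤ 40(4G² + 2Gω)`. [folklore] -/
theorem norm_vecPart_covRel_sub_linear_le (e : Edge 3 L) :
    ‖vecPart (covRel L u ξ w e) - (w e + ξ e.1 - (adRot (u (0, e.2))).mulVec (ξ (e.1.shift e.2)))‖ ≤ 40 * (4 * G ^ 2 + 2 * G * ω) := by
  have hG0 : 0 ≤ G := (norm_nonneg _).trans (hG e.1)
  have hω0 : 0 ≤ ω := (norm_nonneg _).trans (hω e)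
  have hζ : ‖(adRot (u (0, e.2))).mulVec (ξ (e.1.shift e.2))‖ ≤ 2 * G :=
    (norm_adRot_mulVec_le _ _).trans (by linarith [hG (e.1.shift e.2)])
  have h := norm_vecPart_conj_chart_sub_linear_le (ξ := ξ e.1) (w := w e) (ζ := (adRot (u (0, e.2))).mulVec (ξ (e.1.shift e.2)))
    ((hG _).trans (by linarith)) ((hω _).trans (by linarith)) (hζ.trans (by linarith))
  refine h.trans (mul_le_mul_of_nonneg_left ?_ (by norm_num))
  have hmax : max ‖ξ e.1‖ ‖(adRot (u (0, e.2))).mulVec (ξ (e.1.shift e.2))‖ ≤ 2 * G := max_le ((hG _).trans (by linarith)) hζ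
  have hmax0 : 0 ≤ max ‖ξ e.1‖ ‖(adRot (u (0, e.2))).mulVec (ξ (e.1.shift e.2))‖ := le_max_of_le_left (norm_nonneg _)
  have h1 : max ‖ξ e.1‖ ‖(adRot (u (0, e.2))).mulVec (ξ (e.1.shift e.2))‖ ^ 2 ≤ (2 * G) ^ 2 := pow_le_pow_left₀ hmax0 hmax 2
  have h2 : max ‖ξ e.1‖ ‖(adRot (u (0, e.2))).mulVec (ξ (e.1.shift e.2))‖ * ‖w e‖ ≤ (2 * G) * ω := mul_le_mul hmax (hω e) (norm_nonneg _) (by positivity)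
  nlinarith

omit [NeZero L] in
/-- Every link of `covRel` stays in the cap: scalar part `≥ 1/2`. [folklore] -/
theorem half_le_scalarPart_covRel (e : Edge 3 L) : 1 / 2 ≤ scalarPart (covRel L u ξ w e) := by
  have hG0 : 0 ≤ G := (norm_nonneg _).trans (hG e.1)
  have hζ : ‖(adRot (u (0, e.2))).mulVec (ξ (e.1.shift e.2))‖ ≤ 2 * G :=
    (norm_adRot_mulVec_le _ _).trans (by linarith [hG (e.1.shift e.2)])
  exact scalarPart_conj_chart_ge_half ((hG _).trans (by linarith)) ((hω _).trans hω1) (hζ.trans (by linarith))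

/-- Every direction sum of `covRel` is nonzero (scalar sums `≥ N/2 > 0`). [folklore] -/
theorem dirQuat_covRel_ne_zero (k : Fin 3) : dirQuat L k (covRel L u ξ w) ≠ 0 :=
  dirQuat_ne_zero_of_scalarSum_pos L (by
    have h := dirScalarSum_ge_of_half (V := covRel L u ξ w) (half_le_scalarPart_covRel hG hω hG1 hω1) k
    have : (0 : ℝ) < Fintype.card (Site 3 L) := by exact_mod_cast Fintype.card_pos
    linarith)

/-- ★★ **LINEARISATION AT A GENERAL SLOW VARIABLE**: for `U = orthoTube u w` (`w` balanced, `‖w_e‖∞ ≤ ω ≤ 1/20`), `h_x = P(ξ_x)` with `Σ_x ξ_x = 0` and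
`‖ξ_x‖∞ ≤ G ≤ 1/40`: `‖relLinkVec(U^h)_{e,·} − (w_e + ξ_x − Ad(u_k)ξ_y)‖∞ ≤ 440·(4G² + 2Gω)` — the linear part is `w − D_u ξ`, `D_u` the covariant gradient. [folklore] -/
theorem norm_relLinkVec_gaugeTransform_orthoTube_sub_le (hbal : ∀ (k : Fin 3) (a : Fin 3), ∑ x : Site 3 L, w (x, k) a = 0)
    (hmean : ∑ x : Site 3 L, ξ x = 0) (e : Edge 3 L) :
    ‖(fun a => relLinkVec L (gaugeTransform (fun x => chartSU2 (ξ x)) (orthoTube L u w)) (e, a)) - (w e - covGrad L u ξ e)‖ ≤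
      440 * (4 * G ^ 2 + 2 * G * ω) := by
  have hG0 : 0 ≤ G := (norm_nonneg _).trans (hG e.1)
  have hξ1 : ∀ x, ∑ a, ξ x a ^ 2 ≤ 1 := fun x => by
    have h3 := sum_sq_le_three_norm_sq (ξ x)
    have hx : ‖ξ x‖ ≤ 1 / 40 := (hG x).trans hG1
    nlinarith [norm_nonneg (ξ x)]
  rw [gaugeTransform_orthoTube_eq L u ξ w hξ1, relLinkVec_mul_constLift L _ u (dirQuat_covRel_ne_zero hG hω hG1 hω1)]
  have hfun : (fun a => relLinkVec L (covRel L u ξ w) (e, a)) = vecPart (covRel L u ξ w e * (polarMean L e.2 (covRel L u ξ w))⁻¹) := by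
    funext a; rfl
  rw [hfun]
  have hlin' : w e - covGrad L u ξ e = w e + ξ e.1 - (adRot (u (0, e.2))).mulVec (ξ (e.1.shift e.2)) := by
    simp only [covGrad]; abel
  rw [hlin']
  have h := norm_relLink_sub_lin_le (V := covRel L u ξ w) (lin := fun e => w e + ξ e.1 - (adRot (u (0, e.2))).mulVec (ξ (e.1.shift e.2)))
    (ρ := 40 * (4 * G ^ 2 + 2 * G * ω)) (norm_vecPart_covRel_sub_linear_le hG hω hG1 hω1) (half_le_scalarPart_covRel hG hω hG1 hω1)
    (sum_covLin_eq_zero u hbal hmean) e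
  calc _ ≤ 11 * (40 * (4 * G ^ 2 + 2 * G * ω)) := h
    _ = 440 * (4 * G ^ 2 + 2 * G * ω) := by ring

end Main

end Summit.QuantumFields.YangMills.Theorems.FemtoTransferGap.TwoLattice.ConstTube

end
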